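import Summits.KontsevichZagierPeriods.KontsevichZagierPeriods.Theses.HyperbolicBloch
import Summits.KontsevichZagierPeriods.KontsevichZagierPeriods.Theorems.HyperbolicBlochPachnerTwoTwoFree

/-!
# `HyperbolicBloch.PachnerTwoTwo` (stmt-KontsevichZagierPeriods-3474) — named closing theorem

The 2–2 move over a common hemisphere is a KZ relation: `pachnerTwoTwo_proof`, whose type is
literally the route decl `Summit.KontsevichZagierPeriods.KontsevichZagierPeriods.Theses.HyperbolicBloch.PachnerTwoTwo`.
All the mathematics is in the CYCLE-FREE companion module
`Theorems/HyperbolicBlochPachnerTwoTwoFree.lean` (`PachnerTwoTwo_free`, the statement verbatim;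
`pachnerTwoTwo_general`, any common integrand), which does not import the Theses file; this module
only names the result against the route decl.

References: J. Dupont, C.-H. Sah, *Scissors congruences II*, J. Pure Appl. Algebra 25 (1982) §5;
M. Kontsevich, D. Zagier, *Periods* (2001) §1.2 rule (1a).
-/

namespace Summit.KontsevichZagierPeriods.HyperbolicBloch.PachnerTwoTwo

/-- **The route decl `HyperbolicBloch.PachnerTwoTwo` (stmt-KontsevichZagierPeriods-3474) holds.**
For algebraic `u, v, w, q` on one circle in counter-clockwise convex order,
`[P(u,v,w)] + [P(u,w,q)] − [P(u,v,q)] − [P(v,w,q)] ∈ KZ.relations` for representations on the four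
prisms above the common hemisphere with integrand `t⁻³` (the cycle-free `PachnerTwoTwo_free`, whose
type is the decl's body verbatim). -/
theorem pachnerTwoTwo_proof :
    Summit.KontsevichZagierPeriods.KontsevichZagierPeriods.Theses.HyperbolicBloch.PachnerTwoTwo :=
  PachnerTwoTwo_free

end Summit.KontsevichZagierPeriods.HyperbolicBloch.PachnerTwoTwo
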